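import Mathlib
import Summits.Ventures.PercRepro2.ZMeanProof
import Summits.Ventures.PercRepro2.PendantRoot

/-!
# The leaf `a₃` at a root: the cluster of the leaf, the split of the mean-field sum `X̂`, and the
tools of the pinned edge (blind cell PercRepro2, night-1 g6; exploration lens)

Let `a₃` be a LEAF attached to the root `a₂` by the single edge `f` (`q = p f`).  Exploring
`A = C(a₃)`: with `f` closed `A = {a₃}` (`cluster_leaf_of_closed`), with `f` open `A = C(a₂)`
(`cluster_leaf_of_open`); hence (`Xhat_pendant`)

  `X̂ = (1 − q) · termW({a₃}) + Σ_W P(C(a₂) = W, f open) · termW(W)`,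

and `P(Q) · termW({a₃}) = P(Q,oL) P(Q,bH) + P(Q,oH) P(Q,bL)` (`termW_leaf`: the residual world of the
isolated leaf is the leaf-free world).  Tools: `Σ_W P(C(s) = W, A) F(W) = E[1_A F(C(s))]`
(`sum_prob_clusterEvent_inter_mul`), `E[1_{f open} H] = q · E_{p[f↦1]}[H]`
(`expect_indicator_openEdge_mul`), and free events keep their probability with `f` pinned open
(`prob_update_one_of_free`).  Used by `HMFPendantRoot.lean` (the theorem `HMF_pendant_root`).
-/
namespace Summit.Ventures.PercRepro2

open UnionCluster CovForm PendantRoot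

namespace HMFPendantRoot

variable {V : Type*} {E : Type*} [Fintype E] [DecidableEq E] [Fintype V] [DecidableEq V]
  {R : Type*} [Field R] [LinearOrder R] [IsStrictOrderedRing R]

/-! ## The cluster of the leaf -/

section Cluster

variable {ends : E → Sym2 V} {f : E} {a₃ a₂ : V}

omit [Fintype E] [DecidableEq E] [Fintype V] [DecidableEq V] in
/-- With `f` closed the leaf is isolated: `C(a₃) = {a₃}`. -/
lemma cluster_leaf_of_closed (hf : ends f = s(a₃, a₂)) (hleaf : ∀ e, a₃ ∈ ends e → e = f)
    (h32 : a₃ ≠ a₂) {ω : Config E} (hω : ω f = false) : cluster ends ω a₃ = {a₃} := by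
  ext x
  simp only [mem_cluster, Set.mem_singleton_iff]
  constructor
  · intro h
    by_contra hx
    have hx3 : x ≠ a₃ := hx
    have hmem : ω ∈ connEvent ends x a₃ := conn_symm h
    rw [connEvent_other_leaf hf hleaf h32 (Ne.symm hx3)] at hmem
    have := hmem.1
    simp only [mem_openEdge] at this
    rw [this] at hω
    exact Bool.true_eq_false.mp hω
  · rintro rfl
    exact conn_refl ends ω x

omit [Fintype E] [DecidableEq E] [Fintype V] [DecidableEq V] in
/-- With `f` open the leaf sits in the heavy cluster: `C(a₃) = C(a₂)`. -/
lemma cluster_leaf_of_open (hf : ends f = s(a₃, a₂)) {ω : Config E} (hω : ω f = true) :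
    cluster ends ω a₃ = cluster ends ω a₂ :=
  cluster_eq_of_conn (conn_of_openAdj ⟨f, hω, hf⟩)

omit [Fintype E] [DecidableEq E] [Fintype V] [DecidableEq V] in
/-- `{C(a₃) = W} ∩ {f closed}` is `{f closed}` if `W = {a₃}` and empty otherwise. -/
lemma clusterEvent_leaf_inter_closed (hf : ends f = s(a₃, a₂))
    (hleaf : ∀ e, a₃ ∈ ends e → e = f) (h32 : a₃ ≠ a₂) (W : Set V) :
    clusterEvent ends a₃ W ∩ closedEdge f = if W = {a₃} then closedEdge f else ∅ := by
  ext ω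
  simp only [Set.mem_inter_iff, mem_clusterEvent, mem_closedEdge]
  split_ifs with hW
  · subst hW
    simp only [mem_closedEdge, and_iff_right_iff_imp]
    exact fun h => cluster_leaf_of_closed hf hleaf h32 h
  · simp only [Set.mem_empty_iff_false, iff_false, not_and]
    intro h hω
    exact hW (h ▸ cluster_leaf_of_closed hf hleaf h32 hω)

omit [Fintype E] [DecidableEq E] [Fintype V] [DecidableEq V] in
/-- `{C(a₃) = W} ∩ {f open} = {C(a₂) = W} ∩ {f open}`. -/
lemma clusterEvent_leaf_inter_open (hf : ends f = s(a₃, a₂)) (W : Set V) :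
    clusterEvent ends a₃ W ∩ openEdge f = clusterEvent ends a₂ W ∩ openEdge f := by
  ext ω
  simp only [Set.mem_inter_iff, mem_clusterEvent, mem_openEdge]
  constructor
  · rintro ⟨h, hω⟩
    exact ⟨(cluster_leaf_of_open hf hω).symm.trans h, hω⟩
  · rintro ⟨h, hω⟩
    exact ⟨(cluster_leaf_of_open hf hω).trans h, hω⟩

end Cluster

/-! ## The mean-field sum at a pendant root -/

section Xhat

variable (p : E → R) (ends : E → Sym2 V) {f : E} {a₃ a₂ : V}

omit [LinearOrder R] [IsStrictOrderedRing R] in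
/-- The split of `X̂` by the state of the leaf edge: the `{a₃}` row with mass `1 − q` and the
heavy-cluster rows with the mass of `{C(a₂) = W} ∩ {f open}`. -/
lemma Xhat_pendant (hf : ends f = s(a₃, a₂)) (hleaf : ∀ e, a₃ ∈ ends e → e = f)
    (h32 : a₃ ≠ a₂) (o a₁ b : V) :
    Xhat p ends o a₁ a₂ a₃ b =
      (1 - p f) * termW p ends o a₁ a₂ b {a₃} +
        ∑ W : Finset V, prob p (clusterEvent ends a₂ (↑W : Set V) ∩ openEdge f) *
          termW p ends o a₁ a₂ b W := by
  rw [Xhat_eq_sum]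
  have hsplit : ∀ W : Finset V, prob p (clusterEvent ends a₃ (↑W : Set V)) =
      prob p (clusterEvent ends a₂ (↑W : Set V) ∩ openEdge f) +
        (if (↑W : Set V) = {a₃} then prob p (closedEdge f) else 0) := by
    intro W
    rw [← prob_inter_add_prob_inter_compl p (clusterEvent ends a₃ (↑W : Set V)) (openEdge f),
      ← closedEdge_eq_compl, clusterEvent_leaf_inter_open hf,
      clusterEvent_leaf_inter_closed hf hleaf h32]
    congr 1
    split_ifs <;> simp
  simp only [hsplit, add_mul, Finset.sum_add_distrib]
  rw [add_comm]
  congr 1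
  rw [Finset.sum_eq_single ({a₃} : Finset V)]
  · simp [prob_closedEdge]
  · intro W _ hW
    have : (↑W : Set V) ≠ {a₃} := by
      intro h
      apply hW
      rw [← Finset.coe_singleton] at h
      exact Finset.coe_injective h
    simp [this]
  · intro h
    exact absurd (Finset.mem_univ _) h

end Xhat

/-! ## Sums over the cluster as expectations; the pinned edge -/

section Tools

variable (p : E → R) (ends : E → Sym2 V)

omit [DecidableEq V] [LinearOrder R] [IsStrictOrderedRing R] in
/-- `Σ_W P(C(s) = W, A) · F(W) = E[1_A · F(C(s))]` (the sum over the values of the cluster). -/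
lemma sum_prob_clusterEvent_inter_mul (s : V) (A : Set (Config E)) (F : Set V → R) :
    ∑ W : Finset V, prob p (clusterEvent ends s (↑W : Set V) ∩ A) * F (↑W : Set V) =
      expect p (fun ω => A.indicator 1 ω * F (cluster ends ω s)) := by
  classical
  unfold expect prob
  simp_rw [Finset.sum_mul]
  rw [Finset.sum_comm]
  refine Finset.sum_congr rfl fun ω _ => ?_
  rw [Finset.sum_eq_single (cluster ends ω s).toFinset]
  · have hC : (↑(cluster ends ω s).toFinset : Set V) = cluster ends ω s := Set.coe_toFinset _
    by_cases hA : ω ∈ A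
    · have hmem : ω ∈ clusterEvent ends s (↑(cluster ends ω s).toFinset : Set V) ∩ A :=
        ⟨by rw [mem_clusterEvent, hC], hA⟩
      rw [Set.indicator_of_mem hmem, Set.indicator_of_mem hA, hC]
      simp
    · have hmem : ω ∉ clusterEvent ends s (↑(cluster ends ω s).toFinset : Set V) ∩ A :=
        fun h => hA h.2
      rw [Set.indicator_of_notMem hmem, Set.indicator_of_notMem hA]
      simp
  · intro W _ hW
    have hmem : ω ∉ clusterEvent ends s (↑W : Set V) ∩ A := by
      rintro ⟨h, _⟩
      apply hW
      rw [mem_clusterEvent] at h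
      apply Finset.coe_injective
      rw [Set.coe_toFinset, h]
    rw [Set.indicator_of_notMem hmem]
    simp
  · intro h
    exact absurd (Finset.mem_univ _) h

omit [Fintype V] [DecidableEq V] [LinearOrder R] [IsStrictOrderedRing R] in
/-- `E[1_{e open} · H] = p e · E_{p[e↦1]}[H]`. -/
lemma expect_indicator_openEdge_mul (e : E) (H : Config E → R) :
    expect p (fun ω => (openEdge e).indicator 1 ω * H ω) =
      p e * expect (Function.update p e 1) H := by
  rw [expect_eq_pin p _ e]
  have h0 : expect (Function.update p e 0) (fun ω => (openEdge e).indicator 1 ω * H ω) = 0 := by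
    unfold expect
    refine Finset.sum_eq_zero fun ω _ => ?_
    dsimp only
    by_cases h : ω e = true
    · rw [weight_update_zero_of_eq_true p h]; ring
    · simp only [Bool.not_eq_true] at h
      rw [Set.indicator_of_notMem (show ω ∉ openEdge e by simp [h])]
      ring
  have h1 : expect (Function.update p e 1) (fun ω => (openEdge e).indicator 1 ω * H ω) =
      expect (Function.update p e 1) H := by
    unfold expect
    refine Finset.sum_congr rfl fun ω _ => ?_
    dsimp only
    by_cases h : ω e = true
    · rw [Set.indicator_of_mem (show ω ∈ openEdge e by simpa using h)]
      simp
    · simp only [Bool.not_eq_true] at h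
      rw [weight_update_one_of_eq_false p h]
      ring
  rw [h0, h1]
  ring

omit [Fintype V] [DecidableEq V] [LinearOrder R] [IsStrictOrderedRing R] in
/-- A free event has the same probability with `f` pinned open. -/
lemma prob_update_one_of_free {f : E} {A : Set (Config E)} (hA : Free f A) :
    prob (Function.update p f 1) A = prob p A := by
  rw [prob_eq_expect_indicator, prob_eq_expect_indicator, expect_update_one]
  unfold expect
  refine Finset.sum_congr rfl fun ω _ => ?_
  dsimp only
  congr 1
  have hiff : Function.update ω f true ∈ A ↔ ω ∈ A :=
    dependsOn_mem_iff hA fun e he => Function.update_of_ne he _ _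
  by_cases h : ω ∈ A
  · rw [Set.indicator_of_mem h, Set.indicator_of_mem (hiff.2 h)]
    rfl
  · rw [Set.indicator_of_notMem h, Set.indicator_of_notMem (fun h' => h (hiff.1 h'))]

omit [Fintype E] [DecidableEq E] [Fintype V] [DecidableEq V] [LinearOrder R] [IsStrictOrderedRing R] in
/-- An event determined by edges not touching a set `W` with `f ∈ touches W` is free. -/
lemma free_of_dependsOn_touches_compl {f : E} {W : Set V} (hfW : f ∈ touches ends W)
    {A : Set (Config E)} (hA : DependsOn (· ∈ A) (touches ends W)ᶜ) : Free f A := by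
  intro ω ω' h
  exact hA fun e he => h e (fun hef => he (hef ▸ hfW))

end Tools

/-! ## The residual world of the isolated leaf -/

section Singleton

variable (p : E → R) {ends : E → Sym2 V} {f : E} {a₃ a₂ : V}

omit [Fintype E] [DecidableEq E] [Fintype V] [DecidableEq V] in
/-- The edges touching `{a₃}` are exactly `{f}`. -/
lemma touches_leaf (hf : ends f = s(a₃, a₂)) (hleaf : ∀ e, a₃ ∈ ends e → e = f) :
    touches ends (↑({a₃} : Finset V) : Set V) = {f} := by
  ext e
  simp only [mem_touches, Finset.coe_singleton, Set.mem_singleton_iff, exists_eq_left]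
  constructor
  · rintro ⟨y, hy⟩
    exact hleaf e (by rw [hy]; exact Sym2.mem_mk_left _ _)
  · rintro rfl
    exact ⟨a₂, hf⟩

omit [Fintype E] [DecidableEq E] in
/-- Closing the leaf edge does not change connections among the other vertices. -/
lemma connDelEvent_leaf (hf : ends f = s(a₃, a₂)) (hleaf : ∀ e, a₃ ∈ ends e → e = f)
    (h32 : a₃ ≠ a₂) {x v : V} (hx : x ≠ a₃) (hv : v ≠ a₃) :
    connDelEvent ends ({a₃} : Finset V) x v = connEvent ends x v := by
  ext ω
  simp only [mem_connDelEvent, connEvent, Set.mem_setOf_eq]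
  have hagree : ∀ e, e ≠ f → restrict (touches ends (↑({a₃} : Finset V) : Set V))ᶜ ω e = ω e := by
    intro e he
    apply restrict_apply_of_mem
    rw [touches_leaf hf hleaf]
    exact he
  constructor
  · exact conn_of_conn_of_eq_off_leaf hf hleaf h32 hagree hx hv
  · exact conn_of_conn_of_eq_off_leaf hf hleaf h32 (fun e he => (hagree e he).symm) hx hv

omit [Fintype E] [DecidableEq E] in
/-- The residual `Q` of the isolated leaf is `Q`. -/
lemma delQ_leaf (hf : ends f = s(a₃, a₂)) (hleaf : ∀ e, a₃ ∈ ends e → e = f) (h32 : a₃ ≠ a₂)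
    {a₁ : V} (h31 : a₃ ≠ a₁) :
    delQ ends ({a₃} : Finset V) a₁ a₂ = avoidAll ends a₂ {a₁} := by
  rw [delQ, connDelEvent_leaf hf hleaf h32 (Ne.symm h31) (Ne.symm h32), avoidAll_eq_compl]

/-- `P(Q) · termW({a₃}) = P(Q,oL) P(Q,bH) + P(Q,oH) P(Q,bL)`. -/
lemma termW_leaf (hp : IsProbVec p) (hf : ends f = s(a₃, a₂)) (hleaf : ∀ e, a₃ ∈ ends e → e = f) (h32 : a₃ ≠ a₂)
    {o a₁ b : V} (h31 : a₃ ≠ a₁) (ho : o ≠ a₃) (hb : b ≠ a₃) :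
    prob p (avoidAll ends a₂ {a₁}) * termW p ends o a₁ a₂ b {a₃} =
      prob p (avoidAll ends a₂ {a₁} ∩ connEvent ends a₁ o) *
          prob p (avoidAll ends a₂ {a₁} ∩ connEvent ends a₂ b) +
        prob p (avoidAll ends a₂ {a₁} ∩ connEvent ends a₂ o) *
          prob p (avoidAll ends a₂ {a₁} ∩ connEvent ends a₁ b) := by
  have h1 : a₁ ∉ ({a₃} : Finset V) := by simp [Ne.symm h31]
  have h2 : a₂ ∉ ({a₃} : Finset V) := by simp [Ne.symm h32]
  have ho' : o ∉ ({a₃} : Finset V) := by simp [ho]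
  have hb' : b ∉ ({a₃} : Finset V) := by simp [hb]
  simp only [termW, h1, h2, if_false, termPD, delShareMass, ho', hb',
    delQ_leaf hf hleaf h32 h31, connDelEvent_leaf hf hleaf h32 (Ne.symm h31) ho,
    connDelEvent_leaf hf hleaf h32 (Ne.symm h32) hb, connDelEvent_leaf hf hleaf h32 (Ne.symm h32) ho,
    connDelEvent_leaf hf hleaf h32 (Ne.symm h31) hb]
  by_cases hZ : prob p (avoidAll ends a₂ {a₁}) = 0
  · have hmono : ∀ X, prob p (avoidAll ends a₂ {a₁} ∩ X) = 0 := fun X =>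
      le_antisymm (by rw [← hZ]; exact prob_mono hp Set.inter_subset_left) (prob_nonneg hp _)
    simp [hZ, hmono]
  · rw [mul_div_cancel₀ _ hZ]

end Singleton

end HMFPendantRoot

end Summit.Ventures.PercRepro2
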